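import Literature.AlgebraicGeometry.Resolution.WeightedCentreStep
import Literature.AlgebraicGeometry.Resolution.WeightedBlowupGradedStep
import HarnessLib

/-!
# DROP at position 1 and the STALL locus, read off the weighted homogeneous components
(`pub-rosobs`, carver-g38; joins `WeightedCentreStep` (verdict predicates, step germ) and `WeightedBlowupGradedStep`
(the order formula `ord F'(s,u'+b) = min_k (k + ord_b F_{ℓ+k})`))

For a residual `f ∈ k[X_{Fin n}]` of order `ν` with certified maximal invariant `a = max W(f)`, a polynomial `g` (the
residual in the centre's coordinates) all of whose monomials have `w`-weight `≥ ℓ`, and a point `b` of the exceptional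
divisor `{s = 0}` of the weighted blow-up with weights `w`, level `ℓ`:
* `stepDrops_stepGerm_of_component_lt`: if `j + ord_{b|σ}(g_{ℓ+j}) < ν` for some `j ≥ 0` (`g_m` the `w`-weighted
  homogeneous components), the step verdict at `b` is DROP (`StepDrops a (W (stepGerm w ℓ b g))`): the order formula makes
  `ord (stepGerm) < ν`, and the ORDER RULE of `WeightedCentreStep` applies;
* `le_component_of_not_stepDrops` / `le_monomialOrd_initialForm_of_stepStalls`: conversely a point whose verdict is not
  DROP — in particular every STALL point — satisfies `ν ≤ j + ord_{b|σ}(g_{ℓ+j})` for every `j`, and (`j = 0`) lies on the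
  `ν`-fold locus of the initial form `in_w g = g_ℓ` on the weighted normal cone.
This is the kernel form of the census readings "DROP@1 ⟺ face order < a₁" / "STALL only on the ν-fold locus of the cone"
(instrument typing for the step census; [cite: AbramovichQuekSchober2024, Thm. 1.1 (3) and §6] is the curve case, where
the ν-fold locus of `f_{J,1}` off the vertex is empty).  NOT a resolution theorem; NOT summit progress.
-/

open MvPolynomial

namespace Literature.AlgebraicGeometry.Resolution

namespace WeightedBlowup

noncomputable section

variable {k : Type*} [Field k] {n : ℕ}

/-- **DROP at position 1 from the components**: `j + ord_{b|σ}(g_{ℓ+j}) < ν` for some `j` ⇒ `StepDrops a (W (stepGerm w ℓ b g))`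
for the certified maximum `a` of a residual `f` of order `ν`. (derived here)
[cite: AbramovichQuekSchober2024, Thm. 1.1 (3)], [cite: AbramovichTemkinWlodarczyk2024, Thm. 6.2.1 (p. 1581)] -/
theorem stepDrops_stepGerm_of_component_lt {f : MvPolynomial (Fin n) k} {ν : ℕ}
    (hν : monomialOrd (fun _ => 1) f = ν) {a : List ℚ} (ha : IsMaxInv (admissibleInvariants f) a)
    (w : Fin n → ℕ) (ℓ : ℕ) (b : Option (Fin n) → k) (hb0 : b none = 0) (g : MvPolynomial (Fin n) k)
    (hg : ∀ d ∈ g.support, ℓ ≤ Finsupp.weight w d)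
    (h : ∃ j : ℕ, (j : ℕ∞) + monomialOrd (fun _ => 1)
      (PointBlowup.translate (fun i => b (some i)) (weightedHomogeneousComponent w (ℓ + j) g)) < ν) :
    StepDrops a (admissibleInvariants (stepGerm w ℓ b g)) := by
  apply stepDrops_of_isMaxInv_of_monomialOrd_lt hν ha
  rw [monomialOrd_one_stepGerm, monomialOrd_one_pointPolynomial_lt_iff w ℓ b hb0 g hg]
  exact h

/-- **Not DROP ⇒ every layer bound is `≥ ν`**: `ν ≤ j + ord_{b|σ}(g_{ℓ+j})` for all `j`. (derived here)
[cite: AbramovichQuekSchober2024, §6 (ν ≤ ν^log)] -/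
theorem le_component_of_not_stepDrops {f : MvPolynomial (Fin n) k} {ν : ℕ}
    (hν : monomialOrd (fun _ => 1) f = ν) {a : List ℚ} (ha : IsMaxInv (admissibleInvariants f) a)
    (w : Fin n → ℕ) (ℓ : ℕ) (b : Option (Fin n) → k) (hb0 : b none = 0) (g : MvPolynomial (Fin n) k)
    (hg : ∀ d ∈ g.support, ℓ ≤ Finsupp.weight w d)
    (h : ¬ StepDrops a (admissibleInvariants (stepGerm w ℓ b g))) (j : ℕ) :
    (ν : ℕ∞) ≤ (j : ℕ∞) + monomialOrd (fun _ => 1)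
      (PointBlowup.translate (fun i => b (some i)) (weightedHomogeneousComponent w (ℓ + j) g)) := by
  by_contra hlt
  exact h (stepDrops_stepGerm_of_component_lt hν ha w ℓ b hb0 g hg ⟨j, not_le.mp hlt⟩)

/-- **The STALL locus lies on the `ν`-fold locus of the initial form on the weighted normal cone**:
`StepStalls a (W (stepGerm w ℓ b g)) ⇒ ν ≤ ord_{b|σ}(in_w g)`, `in_w g = weightedHomogeneousComponent w ℓ g`. (derived here)
[cite: AbramovichQuekSchober2024, Thm. 1.1 (3) and §6 (curves: f_{J,1} is not a ν-th power, so no such point)],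
[cite: AbramovichQuekSchober2025, Construction 4.2 (the fibre s = 0 is the weighted normal cone)] -/
theorem le_monomialOrd_initialForm_of_stepStalls {f : MvPolynomial (Fin n) k} {ν : ℕ}
    (hν : monomialOrd (fun _ => 1) f = ν) {a : List ℚ} (ha : IsMaxInv (admissibleInvariants f) a)
    (w : Fin n → ℕ) (ℓ : ℕ) (b : Option (Fin n) → k) (hb0 : b none = 0) (g : MvPolynomial (Fin n) k)
    (hg : ∀ d ∈ g.support, ℓ ≤ Finsupp.weight w d)
    (h : StepStalls a (admissibleInvariants (stepGerm w ℓ b g))) :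
    (ν : ℕ∞) ≤ monomialOrd (fun _ => 1)
      (PointBlowup.translate (fun i => b (some i)) (weightedHomogeneousComponent w ℓ g)) := by
  have h0 := le_component_of_not_stepDrops hν ha w ℓ b hb0 g hg (fun hd => not_stepStalls_of_stepDrops hd h) 0
  simpa using h0

/-- The same for a centre `(Ψ, γ)` of `f` in the sense of `WeightedCentreInvariantSet` with integer weights `wᵢ = ℓγᵢ`,
`ℓ > 0`, applied to the residual `g = Ψ⁻¹ f` (its monomials have weight `≥ ℓ` by admissibility). (derived here)
[cite: AbramovichTemkinWlodarczyk2024, Def. 2.4.1 (p. 1568) and Thm. 6.2.1 (p. 1581)] -/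
theorem le_monomialOrd_initialForm_of_stepStalls_of_isCentreFor {f : MvPolynomial (Fin n) k} {ν : ℕ}
    (hν : monomialOrd (fun _ => 1) f = ν) {a : List ℚ} (ha : IsMaxInv (admissibleInvariants f) a)
    {Ψ : MvPolynomial (Fin n) k ≃ₐ[k] MvPolynomial (Fin n) k} {γ : Fin n → ℚ} (hc : IsCentreFor f Ψ γ)
    {w : Fin n → ℕ} {ℓ : ℕ} (hw : ∀ i, (w i : ℚ) = ℓ * γ i) (hℓ : 0 < ℓ)
    (b : Option (Fin n) → k) (hb0 : b none = 0)
    (h : StepStalls a (admissibleInvariants (stepGerm w ℓ b (Ψ.symm f)))) :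
    (ν : ℕ∞) ≤ monomialOrd (fun _ => 1)
      (PointBlowup.translate (fun i => b (some i)) (weightedHomogeneousComponent w ℓ (Ψ.symm f))) :=
  le_monomialOrd_initialForm_of_stepStalls hν ha w ℓ b hb0 (Ψ.symm f)
    (forall_le_weight_of_isAdmissibleFor hℓ hw hc.2.2) h

end

end WeightedBlowup

end Literature.AlgebraicGeometry.Resolution
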